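import Mathlib
import Literature.NumberTheory.Automorphic.HilbertModularFormQExpansion
import Summits.Langlands.Langlands.Theorems.CapacityClassicalityHilbertIntegralOverconvergentIsCongruenceStubBoundedOfCoeffSupport

/-!
# Termwise differentiation of `q`-series in one coordinate
(stub stub_qSeries_slice_deriv of line Sketch-ideate-r1-k1)

Stub X3 of the crux `HilbertIntegralOverconvergentIsCongruence` (stmt-Langlands-8485).  For an
absolutely convergent `q`-series `Q(z) = ∑_{ν ∈ 𝔡⁻¹} a_ν e^{2πi S(νz)}` on the tube domain
`ℍ = halfSpace F ⊆ Point F = ℂ^{Hom(F,ℝ)}` — absolute convergence meaning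
`∑_ν |a_ν| e^{-2π⟨ν, y⟩} < ∞` at every height `y ≫ 0`, `⟨ν, y⟩ = ∑_σ σ(ν) y_σ` — and a real place `σ`:

* the coefficients `2πi σ(ν) a_ν` are again absolutely convergent at every height: with
  `ε = y_σ / 2` one has `2π|σ(ν)| ≤ ε⁻¹ (e^{2πε σ(ν)} + e^{-2πε σ(ν)})` (from `1 + x ≤ eˣ`), and the
  two exponentials are absorbed by moving the height to `y ∓ ε e_σ ≫ 0`;
* on `ℍ` the derivative of `Q` in the coordinate `z_σ` (the slice derivative of
  `t ↦ Q(update z σ t)` at `t = z_σ`) is the `q`-series with coefficients `2πi σ(ν) a_ν`: along the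
  slice `S(ν · update z σ t) = S(νz) + σ(ν)(t - z_σ)`, so each term has derivative `2πi σ(ν)` times
  itself, and on the strip of heights `Im z_σ / 2 < Im t < 2 Im z_σ` (open, convex) the derivatives
  are dominated by the summable majorant given by the first part at the two extreme heights;
  Mathlib's `hasDerivAt_tsum_of_isPreconnected` differentiates the series termwise.
-/

set_option linter.dupNamespace false

noncomputable section

namespace Summit.Langlands.Langlands.Theorems.HilbertIntegralOverconvergentIsCongruence

open MeasureTheory Complex NumberField
open Literature.NumberTheory.Automorphic Literature.NumberTheory.Automorphic.HilbertModular
open scoped MatrixGroups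

/-- A weighted sum against a function updated at one index: `∑_j c_j (update y i t)_j =
∑_j c_j y_j + c_i (t - y_i)`. [folklore] -/
theorem qsd_sum_mul_update {ι R : Type*} [Fintype ι] [DecidableEq ι] [CommRing R] (c y : ι → R)
    (i : ι) (t : R) :
    ∑ j, c j * Function.update y i t j = ∑ j, c j * y j + c i * (t - y i) := by
  have h1 : (fun j ↦ c j * Function.update y i t j) =
      Function.update (fun j ↦ c j * y j) i (c i * t) := by
    funext j
    by_cases h : j = i
    · subst h; simp
    · simp [Function.update_of_ne h]
  rw [h1, Finset.sum_update_of_mem (Finset.mem_univ i),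
    Finset.sum_eq_add_sum_sdiff_singleton_of_mem (Finset.mem_univ i) (fun j ↦ c j * y j)]
  ring

/-- The pairing along a coordinate slice: `S(ν · update z σ t) = S(νz) + σ(ν) (t - z_σ)`. [folklore] -/
theorem qsd_pairing_update {F : Type} [Field F] [NumberField F] [DecidableEq (F →+* ℝ)] (ν : F)
    (z : Point F) (σ : F →+* ℝ) (t : ℂ) :
    pairing ν (Function.update z σ t) = pairing ν z + ((σ ν : ℝ) : ℂ) * (t - z σ) := by
  unfold pairing
  exact qsd_sum_mul_update _ _ _ _

/-- Imaginary part of the exponent along a coordinate slice: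
`∑_σ' σ'(ν) Im (update z σ t)_σ' = ∑_σ' σ'(ν) Im z_σ' + σ(ν) (Im t - Im z_σ)`. [folklore] -/
theorem qsd_sum_mul_im_update {F : Type} [Field F] [NumberField F] [DecidableEq (F →+* ℝ)] (ν : F)
    (z : Point F) (σ : F →+* ℝ) (t : ℂ) :
    ∑ σ' : F →+* ℝ, σ' ν * (Function.update z σ t σ').im =
      ∑ σ' : F →+* ℝ, σ' ν * (z σ').im + σ ν * (t.im - (z σ).im) := by
  have h : ∀ σ', (Function.update z σ t σ').im = Function.update (fun k ↦ (z k).im) σ t.im σ' := by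
    intro σ'
    by_cases hσ : σ' = σ
    · subst hσ; simp
    · simp [Function.update_of_ne hσ]
  simp_rw [h]
  exact qsd_sum_mul_update _ _ _ _

/-- Each slice term `t ↦ b e^{2πi S(ν · update z σ t)}` has derivative `2πi σ(ν)` times itself
(chain rule with the affine exponent `S(νz) + σ(ν)(t - z_σ)`). [folklore] -/
theorem qsd_hasDerivAt_term {F : Type} [Field F] [NumberField F] [DecidableEq (F →+* ℝ)] (b : ℂ)
    (ν : F) (z : Point F) (σ : F →+* ℝ) (t : ℂ) :
    HasDerivAt (fun t : ℂ ↦ b * cexp (2 * Real.pi * I * pairing ν (Function.update z σ t)))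
      ((2 * Real.pi * I * ((σ ν : ℝ) : ℂ) * b) *
        cexp (2 * Real.pi * I * pairing ν (Function.update z σ t))) t := by
  simp only [qsd_pairing_update]
  have h1 : HasDerivAt (fun t : ℂ ↦ 2 * Real.pi * I * (pairing ν z + ((σ ν : ℝ) : ℂ) * (t - z σ)))
      (2 * Real.pi * I * (((σ ν : ℝ) : ℂ) * 1)) t :=
    ((((hasDerivAt_id' t).sub_const (z σ)).const_mul ((σ ν : ℝ) : ℂ)).const_add
      (pairing ν z)).const_mul (2 * Real.pi * I)
  refine ((h1.cexp).const_mul b).congr_deriv ?_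
  ring

/-- The slope bound `2π|s| ≤ ε⁻¹ (e^{2πεs} + e^{-2πεs})` for `ε > 0` (from
`1 + |x| ≤ e^{|x|} ≤ eˣ + e⁻ˣ` at `x = 2πεs`). [folklore] -/
theorem qsd_two_pi_abs_le (s ε : ℝ) (hε : 0 < ε) :
    2 * Real.pi * |s| ≤
      ε⁻¹ * (Real.exp (2 * Real.pi * ε * s) + Real.exp (-(2 * Real.pi * ε * s))) := by
  have h0 : ∀ x : ℝ, |x| ≤ Real.exp x + Real.exp (-x) := fun x ↦ by
    have h1 : |x| + 1 ≤ Real.exp |x| := Real.add_one_le_exp |x|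
    rcases le_total 0 x with hx | hx
    · rw [abs_of_nonneg hx] at h1 ⊢; linarith [Real.exp_pos (-x)]
    · rw [abs_of_nonpos hx] at h1 ⊢; linarith [Real.exp_pos x]
  have h := h0 (2 * Real.pi * ε * s)
  rw [abs_mul, abs_of_pos (by positivity : 0 < 2 * Real.pi * ε)] at h
  rw [le_inv_mul_iff₀ hε]
  calc ε * (2 * Real.pi * |s|) = 2 * Real.pi * ε * |s| := by ring
    _ ≤ _ := h

/-- The size of the differentiated coefficient: `|2πi s a| = 2π |s| |a|`. [folklore] -/
theorem qsd_norm_coeff (a : ℂ) (s : ℝ) : ‖2 * Real.pi * I * (s : ℂ) * a‖ = 2 * Real.pi * |s| * ‖a‖ := by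
  simp [Complex.norm_real, abs_of_pos Real.pi_pos]

/-- Coefficient growth bound: for `ε > 0`,
`|2πi s a| e^{-2πP} ≤ ε⁻¹ (|a| e^{-2π(P - εs)} + |a| e^{-2π(P + εs)})`, from
`2π|s| ≤ ε⁻¹ (e^{2πεs} + e^{-2πεs})`. [folklore] -/
theorem qsd_coeff_bound (a : ℂ) (s P ε : ℝ) (hε : 0 < ε) :
    ‖2 * Real.pi * I * (s : ℂ) * a‖ * Real.exp (-(2 * Real.pi * P)) ≤
      ε⁻¹ * (‖a‖ * Real.exp (-(2 * Real.pi * (P - ε * s))) +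
        ‖a‖ * Real.exp (-(2 * Real.pi * (P + ε * s)))) := by
  have hkey := qsd_two_pi_abs_le s ε hε
  have hexp1 : Real.exp (-(2 * Real.pi * (P - ε * s))) =
      Real.exp (2 * Real.pi * ε * s) * Real.exp (-(2 * Real.pi * P)) := by
    rw [← Real.exp_add]; congr 1; ring
  have hexp2 : Real.exp (-(2 * Real.pi * (P + ε * s))) =
      Real.exp (-(2 * Real.pi * ε * s)) * Real.exp (-(2 * Real.pi * P)) := by
    rw [← Real.exp_add]; congr 1; ring
  calc ‖2 * Real.pi * I * (s : ℂ) * a‖ * Real.exp (-(2 * Real.pi * P))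
      = (2 * Real.pi * |s|) * (‖a‖ * Real.exp (-(2 * Real.pi * P))) := by rw [qsd_norm_coeff]; ring
    _ ≤ (ε⁻¹ * (Real.exp (2 * Real.pi * ε * s) + Real.exp (-(2 * Real.pi * ε * s)))) *
          (‖a‖ * Real.exp (-(2 * Real.pi * P))) :=
        mul_le_mul_of_nonneg_right hkey (by positivity)
    _ = _ := by rw [hexp1, hexp2]; ring

/-- Coefficient growth bound at heights: with `y± = update y σ (y σ ± ε)`,
`|2πi σ(ν) a| e^{-2π⟨ν,y⟩} ≤ ε⁻¹ (|a| e^{-2π⟨ν,y₋⟩} + |a| e^{-2π⟨ν,y₊⟩})`. [folklore] -/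
theorem qsd_coeff_bound_heights {F : Type} [Field F] [NumberField F] [DecidableEq (F →+* ℝ)] (a : ℂ)
    (ν : F) (y : (F →+* ℝ) → ℝ) (σ : F →+* ℝ) (ε : ℝ) (hε : 0 < ε) :
    ‖2 * Real.pi * I * ((σ ν : ℝ) : ℂ) * a‖ * Real.exp (-(2 * Real.pi * ∑ σ' : F →+* ℝ, σ' ν * y σ')) ≤
      ε⁻¹ * (‖a‖ * Real.exp (-(2 * Real.pi *
          ∑ σ' : F →+* ℝ, σ' ν * Function.update y σ (y σ - ε) σ')) +
        ‖a‖ * Real.exp (-(2 * Real.pi *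
          ∑ σ' : F →+* ℝ, σ' ν * Function.update y σ (y σ + ε) σ'))) := by
  rw [qsd_sum_mul_update, qsd_sum_mul_update]
  have h1 : ∑ σ' : F →+* ℝ, σ' ν * y σ' + σ ν * (y σ - ε - y σ) =
      ∑ σ' : F →+* ℝ, σ' ν * y σ' - ε * σ ν := by ring
  have h2 : ∑ σ' : F →+* ℝ, σ' ν * y σ' + σ ν * (y σ + ε - y σ) =
      ∑ σ' : F →+* ℝ, σ' ν * y σ' + ε * σ ν := by ring
  rw [h1, h2]
  exact qsd_coeff_bound a (σ ν) _ ε hε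

/-- On the strip `c/2 < m < 2c` an exponential whose exponent is affine in `m` is dominated by the
sum of its values at the two ends, whatever the sign of the slope. [folklore] -/
theorem qsd_exp_strip_le (K P s c m : ℝ) (hK : 0 ≤ K) (h1 : c / 2 < m) (h2 : m < 2 * c) :
    K * Real.exp (-(2 * Real.pi * (P + s * (m - c)))) ≤
      K * Real.exp (-(2 * Real.pi * (P + s * (c / 2 - c)))) +
        K * Real.exp (-(2 * Real.pi * (P + s * (2 * c - c)))) := by
  rcases le_total 0 s with hs | hs
  · have hle : Real.exp (-(2 * Real.pi * (P + s * (m - c)))) ≤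
        Real.exp (-(2 * Real.pi * (P + s * (c / 2 - c)))) := by
      apply Real.exp_le_exp.2
      have hsm : s * (c / 2 - c) ≤ s * (m - c) := by nlinarith
      have := mul_le_mul_of_nonneg_left (add_le_add_left hsm P)
        (by positivity : (0 : ℝ) ≤ 2 * Real.pi)
      linarith
    exact le_add_of_le_of_nonneg (mul_le_mul_of_nonneg_left hle hK) (by positivity)
  · have hle : Real.exp (-(2 * Real.pi * (P + s * (m - c)))) ≤
        Real.exp (-(2 * Real.pi * (P + s * (2 * c - c)))) := by
      apply Real.exp_le_exp.2
      have hsm : s * (2 * c - c) ≤ s * (m - c) := by nlinarith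
      have := mul_le_mul_of_nonneg_left (add_le_add_left hsm P)
        (by positivity : (0 : ℝ) ≤ 2 * Real.pi)
      linarith
    exact le_add_of_nonneg_of_le (by positivity) (mul_le_mul_of_nonneg_left hle hK)

/-- Domination of the differentiated slice terms on the strip `Im z_σ / 2 < Im t < 2 Im z_σ` by the
values of the differentiated coefficients at the two extreme heights. [folklore] -/
theorem qsd_deriv_term_bound {F : Type} [Field F] [NumberField F] [DecidableEq (F →+* ℝ)] (b : ℂ)
    (ν : F) (z : Point F) (σ : F →+* ℝ) {t : ℂ} (h1 : (z σ).im / 2 < t.im)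
    (h2 : t.im < 2 * (z σ).im) :
    ‖(2 * Real.pi * I * ((σ ν : ℝ) : ℂ) * b) *
        cexp (2 * Real.pi * I * pairing ν (Function.update z σ t))‖ ≤
      ‖2 * Real.pi * I * ((σ ν : ℝ) : ℂ) * b‖ * Real.exp (-(2 * Real.pi *
          ∑ σ' : F →+* ℝ, σ' ν * Function.update (fun σ' ↦ (z σ').im) σ ((z σ).im / 2) σ')) +
        ‖2 * Real.pi * I * ((σ ν : ℝ) : ℂ) * b‖ * Real.exp (-(2 * Real.pi *
          ∑ σ' : F →+* ℝ, σ' ν * Function.update (fun σ' ↦ (z σ').im) σ (2 * (z σ).im) σ')) := by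
  rw [bcs_norm_term, qsd_sum_mul_im_update, qsd_sum_mul_update, qsd_sum_mul_update]
  exact qsd_exp_strip_le _ _ _ _ _ (norm_nonneg _) h1 h2

/-- Part (1) of the stub: the differentiated coefficients `2πi σ(ν) a_ν` are tube-summable at every
height (compare with the heights `y ∓ (y_σ/2) e_σ`). [folklore] -/
theorem qsd_summable_coeff (F : Type) [Field F] [NumberField F] [DecidableEq (F →+* ℝ)] (a : F → ℂ)
    (habs : ∀ y : (F →+* ℝ) → ℝ, (∀ σ, 0 < y σ) →
      Summable (fun ν : {ν : F | ∀ b : 𝓞 F, ∃ n : ℤ, Algebra.trace ℚ F (ν * b) = n} ↦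
        ‖a ν‖ * Real.exp (-(2 * Real.pi * ∑ σ : F →+* ℝ, σ (ν : F) * y σ))))
    (σ : F →+* ℝ) (y : (F →+* ℝ) → ℝ) (hy : ∀ σ', 0 < y σ') :
    Summable (fun ν : {ν : F | ∀ b : 𝓞 F, ∃ n : ℤ, Algebra.trace ℚ F (ν * b) = n} ↦
      ‖2 * Real.pi * I * ((σ (ν : F) : ℝ) : ℂ) * a ν‖ *
        Real.exp (-(2 * Real.pi * ∑ σ' : F →+* ℝ, σ' (ν : F) * y σ'))) := by
  have hε : 0 < y σ / 2 := by linarith [hy σ]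
  have hy₁ : ∀ σ', 0 < Function.update y σ (y σ - y σ / 2) σ' := by
    intro σ'
    by_cases h : σ' = σ
    · subst h; rw [Function.update_self]; linarith [hy σ']
    · rw [Function.update_of_ne h]; exact hy σ'
  have hy₂ : ∀ σ', 0 < Function.update y σ (y σ + y σ / 2) σ' := by
    intro σ'
    by_cases h : σ' = σ
    · subst h; rw [Function.update_self]; linarith [hy σ']
    · rw [Function.update_of_ne h]; exact hy σ'
  have hs := ((habs _ hy₁).add (habs _ hy₂)).mul_left (y σ / 2)⁻¹
  exact Summable.of_nonneg_of_le (fun ν ↦ mul_nonneg (norm_nonneg _) (Real.exp_pos _).le)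
    (fun ν ↦ qsd_coeff_bound_heights (a ν) (ν : F) y σ (y σ / 2) hε) hs

open Classical in
/-- **stub X3 — `stub_qSeries_slice_deriv` (L; termwise differentiation of `q`-series in one coordinate).** For an absolutely
convergent `q`-series `Q(z) = ∑_{ν ∈ 𝔡⁻¹} a_ν e^{2πi S(νz)}` (tube summability at every height), the coefficients `2πi σ(ν) a_ν` are
again tube-summable at every height (`|σ(ν)| ≤ ε⁻¹(e^{2πε σ(ν)} + e^{-2πε σ(ν)})`, heights `y ± ε e_σ`), and on `ℍ` the slice
derivative of `Q` in the coordinate `σ` is the `q`-series with these coefficients (one-variable termwise differentiation on a strip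
of heights, `hasDerivAt_tsum_of_isPreconnected`). [folklore] -/
theorem stub_qSeries_slice_deriv (F : Type) [Field F] [NumberField F] [NumberField.IsTotallyReal F] (a : F → ℂ)
    (habs : ∀ y : (F →+* ℝ) → ℝ, (∀ σ, 0 < y σ) →
      Summable (fun ν : {ν : F | ∀ b : 𝓞 F, ∃ n : ℤ, Algebra.trace ℚ F (ν * b) = n} ↦
        ‖a ν‖ * Real.exp (-(2 * Real.pi * ∑ σ : F →+* ℝ, σ (ν : F) * y σ))))
    (σ : F →+* ℝ) :
    (∀ y : (F →+* ℝ) → ℝ, (∀ σ', 0 < y σ') →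
      Summable (fun ν : {ν : F | ∀ b : 𝓞 F, ∃ n : ℤ, Algebra.trace ℚ F (ν * b) = n} ↦
        ‖2 * Real.pi * I * ((σ (ν : F) : ℝ) : ℂ) * a ν‖ *
          Real.exp (-(2 * Real.pi * ∑ σ' : F →+* ℝ, σ' (ν : F) * y σ')))) ∧
    ∀ z ∈ halfSpace F,
      deriv (fun t : ℂ ↦ ∑' ν : {ν : F | ∀ b : 𝓞 F, ∃ n : ℤ, Algebra.trace ℚ F (ν * b) = n},
          a ν * cexp (2 * Real.pi * I * pairing (ν : F) (Function.update z σ t))) (z σ) =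
        ∑' ν : {ν : F | ∀ b : 𝓞 F, ∃ n : ℤ, Algebra.trace ℚ F (ν * b) = n},
          (2 * Real.pi * I * ((σ (ν : F) : ℝ) : ℂ) * a ν) * cexp (2 * Real.pi * I * pairing (ν : F) z) := by
  have part1 := qsd_summable_coeff F a habs σ
  refine ⟨part1, fun z hz ↦ ?_⟩
  have hc : 0 < (z σ).im := mem_halfSpace_iff.1 hz σ
  -- the strip of heights around `Im z_σ`
  have hS_open : IsOpen ({t : ℂ | (z σ).im / 2 < t.im} ∩ {t : ℂ | t.im < 2 * (z σ).im}) :=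
    (isOpen_lt continuous_const Complex.continuous_im).inter
      (isOpen_lt Complex.continuous_im continuous_const)
  have hS_conn : IsPreconnected ({t : ℂ | (z σ).im / 2 < t.im} ∩ {t : ℂ | t.im < 2 * (z σ).im}) :=
    ((convex_halfSpace_im_gt _).inter (convex_halfSpace_im_lt _)).isPreconnected
  have hmem : z σ ∈ ({t : ℂ | (z σ).im / 2 < t.im} ∩ {t : ℂ | t.im < 2 * (z σ).im}) :=
    ⟨by show (z σ).im / 2 < (z σ).im; linarith, by show (z σ).im < 2 * (z σ).im; linarith⟩
  -- the two extreme heights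
  have hY₁ : ∀ σ', 0 < Function.update (fun σ' ↦ (z σ').im) σ ((z σ).im / 2) σ' := by
    intro σ'
    by_cases h : σ' = σ
    · subst h; rw [Function.update_self]; linarith
    · rw [Function.update_of_ne h]; exact mem_halfSpace_iff.1 hz σ'
  have hY₂ : ∀ σ', 0 < Function.update (fun σ' ↦ (z σ').im) σ (2 * (z σ).im) σ' := by
    intro σ'
    by_cases h : σ' = σ
    · subst h; rw [Function.update_self]; linarith
    · rw [Function.update_of_ne h]; exact mem_halfSpace_iff.1 hz σ'
  have hu := (part1 _ hY₁).add (part1 _ hY₂)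
  -- summability at the base point
  have hsum0 : Summable (fun ν : {ν : F | ∀ b : 𝓞 F, ∃ n : ℤ, Algebra.trace ℚ F (ν * b) = n} ↦
      a ν * cexp (2 * Real.pi * I * pairing (ν : F) (Function.update z σ (z σ)))) := by
    rw [Function.update_eq_self]
    refine Summable.of_norm ?_
    simp only [bcs_norm_term]
    exact habs _ (mem_halfSpace_iff.1 hz)
  have key : HasDerivAt
      (fun t : ℂ ↦ ∑' ν : {ν : F | ∀ b : 𝓞 F, ∃ n : ℤ, Algebra.trace ℚ F (ν * b) = n},
        a ν * cexp (2 * Real.pi * I * pairing (ν : F) (Function.update z σ t)))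
      (∑' ν : {ν : F | ∀ b : 𝓞 F, ∃ n : ℤ, Algebra.trace ℚ F (ν * b) = n},
        (2 * Real.pi * I * ((σ (ν : F) : ℝ) : ℂ) * a ν) *
          cexp (2 * Real.pi * I * pairing (ν : F) (Function.update z σ (z σ)))) (z σ) :=
    hasDerivAt_tsum_of_isPreconnected hu hS_open hS_conn
      (fun ν t _ ↦ qsd_hasDerivAt_term (a ν) (ν : F) z σ t)
      (fun ν t ht ↦ qsd_deriv_term_bound (a ν) (ν : F) z σ ht.1 ht.2) hmem hsum0 hmem
  rw [key.deriv, Function.update_eq_self]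

end Summit.Langlands.Langlands.Theorems.HilbertIntegralOverconvergentIsCongruence
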